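import Mathlib
import HarnessLib
import Literature.RingTheory.CohomologyAnnihilator.Basic
import Literature.RingTheory.CohomologyAnnihilator.StrongGenerator
import Literature.RingTheory.CohomologyAnnihilator.SyzygyBasic
import Literature.RingTheory.CohomologyAnnihilator.SyzygyDescent
import Summits.ResolutionOfSingularities.ResolutionOfSingularities.Theorems.HomologicalConductorNoZenoStableAnnihilatorReduction
import Summits.ResolutionOfSingularities.ResolutionOfSingularities.Theorems.HomologicalConductorPersistenceCompletionAscentSyzygyRetract

/-!
# Ω-RECURRENCE CERTIFICATES — the kernel shape: a recurrent witness module decides membership in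
# `ca(T)` at ALL levels, and the saturation `ca(T) = caᵈ⁺¹(T)` follows from the retract property at ONE level

Route `ResolutionOfSingularities/HomologicalConductor`, chain W4.4b, rung S-2 `PersistenceSurface`
(stmt-ResolutionOfSingularities-19970); seat res-L1-w44b-stub-2 (gen 5), row «Ω-recurrence certificates —
kernel shape» of the plan-1 SEAT PLAN 2026-08-27T17:13:05Z / lead-1 WAVE PLAN 17:22:33Z.
[OURS · L1 w44b; AI-written, weaker than expert review; NOT a statement of the manuscript under study
(Hironaka 2017), and no statement of that manuscript is used.]

THE PROVISO.  The chain's ceiling engines (rank-one / MF-isotypic / `Ωʲ(T/𝔞)` batteries) decide, for a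
stage `T`, an element `x` and ONE finitely generated witness module, whether `x • 𝟙` factors through a
projective on a computed syzygy module `K = Ωⁿ M` — i.e. whether `x` STABLY ANNIHILATES `K`
(`StablyAnnihilates`, A0 of `Theorems/HomologicalConductorNoZenoStableAnnihilatorReduction.lean`).  By the
reduction lemma CA1 (`mem_cohomologyAnnihilatorOfDegree_succ_iff_forall_isSyzygy`) a failure is the
LEVEL-WISE exclusion `x ∉ caⁿ⁺¹(T)`; the route's `ca(T) = ⋃ₙ caⁿ(T)` needs ALL levels.  The missing input is
an Ω-RECURRENCE of the witness (plan-1 17:5xZ at `T₂`, class `χ = (1,4)`: generator counts `2,3,6,12,24,48`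
"suggesting `Ω³ ≅ Ω² ⊕ Ω²` … an Ω-recurrent witness that would put `x₁` outside the FULL `ca(T₂)`";
stub-3's «`S₃ ⊆ S₄`» for the finite set of indecomposable MCM summands at a rational stage; tri-2's
S2-REC-ENGINE).  This file is the module theory that turns such a certificate into the all-level statement,
over the tree's `IsSyzygy` / `StablyAnnihilates` / CA1 vocabulary (folklore in the style of
[IyengarTakahashi2014, §2]; nothing is cited as a premise):

* § Bookkeeping — `isSyzygy_one_punit_of_projective`, `isSyzygy_one_prod_projective`,
  `isSyzygy_succ_prod_projective`: adding a finitely generated projective summand to a syzygy module of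
  positive degree keeps it a syzygy module of the same module.
* § Recurrent classes — a predicate `𝒞` on `ModuleCat T` is RECURRENT when every member is finitely
  generated and is a retract of a FIRST syzygy module of some member (hypotheses `hfin`, `hrec`; e.g.
  `add S₃` under «`S₃ ⊆ S₄`», or `{K, ΩK}` under `Ω²K ≅ ΩK ⊕ ΩK`-type doublings).
  `exists_retract_isSyzygy_of_recurrent`: then every member is a retract of an `n`-th syzygy module of a
  member for EVERY `n`; hence `stablyAnnihilates_of_mem_cohomologyAnnihilator_of_recurrent`: every
  `x ∈ ca(T)` stably annihilates every member, and **`not_mem_cohomologyAnnihilator_of_recurrent`**: ONE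
  member `X` with `x ∉ s̲ann(X)` puts `x` outside `caᵐ(T)` for EVERY `m`
  (`not_mem_cohomologyAnnihilatorOfDegree_of_recurrent`); Ext-witness form
  `not_mem_cohomologyAnnihilator_of_recurrent_of_smul_ext_ne_zero`.
* § One recurrent module — `not_mem_cohomologyAnnihilator_of_retract_isSyzygy`: `K` finitely generated and a
  retract of some `p`-th syzygy module of itself (`p ≥ 1`), `x ∉ s̲ann(K)` ⇒ `x ∉ ca(T)`; the periodic case
  `IsSyzygy p K K` (`not_mem_cohomologyAnnihilator_of_isSyzygy_self`) is the abstract form of the tree's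
  matrix-factorisation LOST criterion (`…PersistenceLostAssembly`, `p = 2`); base-module form
  `not_mem_cohomologyAnnihilator_of_isSyzygy_of_retract_isSyzygy` (`K = Ωⁿ M` a retract of `Ωⁿ⁺ᵖ M`) and
  its Ext-witness form via `not_stablyAnnihilates_of_isSyzygy_of_smul_ext_ne_zero`
  (`x • Extⁱ(M, N) ≠ 0` for some `i ≥ n + 1` ⇒ `x ∉ s̲ann(Ωⁿ M)`).
* § Saturation from one level — **`cohomologyAnnihilator_eq_of_forall_isSyzygy_retract_at`**: over a
  noetherian `T`, if every `d`-th syzygy module of every finitely generated module is a retract of a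
  `(d+1)`-th syzygy module of a finitely generated module (the retract property `(SC_d)` at the SINGLE
  level `d`), then `caⁿ(T) = caᵈ⁺¹(T)` for all `n ≥ d + 1` and `ca(T) = caᵈ⁺¹(T)` — the class of retracts
  of `d`-th syzygy modules is recurrent.  This removes the «for every `m ≥ n`» from the hypothesis of
  `…PersistenceSaturationCriterion.cohomologyAnnihilator_eq_of_forall_isSyzygy_retract` (p-id of record
  in CHAIN §V13.1 "SC"): `Sat_{d+1}` at a stage is decided by ONE syzygy level.

References (mechanism only): S. B. Iyengar, R. Takahashi, *Annihilation of cohomology and strong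
generation of module categories*, IMRN 2016, arXiv:1404.1476, §2 (Remark 2.3, Remark 2.13)
[`IyengarTakahashi2014`].
-/

noncomputable section

-- single-problem summit: the doubled namespace component `ResolutionOfSingularities` is forced
set_option linter.dupNamespace false

namespace Summit.ResolutionOfSingularities.ResolutionOfSingularities.Theorems.HomologicalConductor.RecurrenceExclusion

open CategoryTheory CategoryTheory.Abelian Literature.RingTheory.CohomologyAnnihilator
open Summit.ResolutionOfSingularities.ResolutionOfSingularities.Theorems.NoZeno.SandwichCluster
open Summit.ResolutionOfSingularities.ResolutionOfSingularities.Theorems.HomologicalConductor.CompletionAscentSyzygyRetract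

universe u

variable {T : Type u} [CommRing T]

/-! ## Bookkeeping: projective summands of syzygy modules -/

/-- A finitely generated projective `Q` is a first syzygy module of the zero module:
`0 → Q → Q → 0 → 0`. [folklore] -/
theorem isSyzygy_one_punit_of_projective {Q : ModuleCat.{u} T} (hQ : Module.Finite T Q)
    (hQproj : Projective Q) : IsSyzygy 1 (ModuleCat.of T PUnit.{u + 1}) Q := by
  rw [isSyzygy_one_iff]
  obtain ⟨w, hS⟩ := exists_shortExact_of_linearMap (Y := Q) (M := Q)
    (X := ModuleCat.of T PUnit.{u + 1}) LinearMap.id (0 : Q →ₗ[T] PUnit.{u + 1})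
    Function.injective_id (fun x => ⟨0, Subsingleton.elim _ _⟩)
    (fun y => ⟨fun _ => ⟨y, rfl⟩, fun _ => rfl⟩)
  exact ⟨Q, hQ, hQproj, _, _, w, hS⟩

/-- Adding a finitely generated projective summand to a FIRST syzygy module: if `K = Ω¹ M` then
`K ⊕ Q` is again a first syzygy module of `M` (`0 → K ⊕ Q → P ⊕ Q → M → 0`). [folklore] -/
theorem isSyzygy_one_prod_projective {M K Q : ModuleCat.{u} T} (h : IsSyzygy 1 M K)
    (hQ : Module.Finite T Q) (hQproj : Projective Q) : IsSyzygy 1 M (ModuleCat.of T (K × Q)) :=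
  (h.prod (isSyzygy_one_punit_of_projective hQ hQproj)).of_iso_base
    (LinearEquiv.prodUnique (R := T) (M := M) (M₂ := PUnit.{u + 1})).toModuleIso

/-- Adding a finitely generated projective summand to a syzygy module of POSITIVE degree: if
`K = Ωˢ⁺¹ M` then `K ⊕ Q` is again an `(s+1)`-th syzygy module of `M`. [folklore] -/
theorem isSyzygy_succ_prod_projective {s : ℕ} {M K Q : ModuleCat.{u} T} (h : IsSyzygy (s + 1) M K)
    (hQ : Module.Finite T Q) (hQproj : Projective Q) : IsSyzygy (s + 1) M (ModuleCat.of T (K × Q)) := by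
  obtain ⟨K', P, hK', hP, hproj, f, g, w, hS⟩ := h
  have h1 : IsSyzygy 1 K' K := isSyzygy_one_iff.mpr ⟨P, hP, hproj, f, g, w, hS⟩
  have := hK'.trans (isSyzygy_one_prod_projective h1 hQ hQproj)
  rwa [Nat.add_comm] at this

/-- A retract of a finitely generated module is finitely generated. [folklore] -/
theorem finite_of_retract {X Z : ModuleCat.{u} T} (i : X ⟶ Z) (p : Z ⟶ X) (hip : i ≫ p = 𝟙 X)
    (hZ : Module.Finite T Z) : Module.Finite T X := by
  haveI := hZ
  exact Module.Finite.of_surjective p.hom fun x => ⟨i.hom x, retract_apply hip x⟩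

/-! ## Recurrent classes of modules -/

section Recurrent

variable [IsNoetherianRing T] (𝒞 : ModuleCat.{u} T → Prop)

/-- **Recurrence propagates to every level.** Let `𝒞` be a RECURRENT class of `T`-modules: every
member is finitely generated (`hfin`) and is a retract of a first syzygy module of some member (`hrec`).
Then for every `n`, every member `X` is a retract of an `n`-th syzygy module `N = Ωⁿ Y` of some member
`Y`.  Induction: `X` is a retract of `Ω Y₁`, `Y₁ ∈ 𝒞` a retract of `Ωⁿ Y`, `Y ∈ 𝒞`; a first syzygy of a
retract is a retract of `Ω(Ωⁿ Y) ⊕ Q` (`exists_retract_isSyzygy_of_retract`, Schanuel), and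
`Ωⁿ⁺¹ Y ⊕ Q` is an `(n+1)`-th syzygy module of `Y`. [folklore] -/
theorem exists_retract_isSyzygy_of_recurrent (hfin : ∀ X, 𝒞 X → Module.Finite T X)
    (hrec : ∀ X, 𝒞 X → ∃ (Y N : ModuleCat.{u} T) (i : X ⟶ N) (r : N ⟶ X),
      𝒞 Y ∧ IsSyzygy 1 Y N ∧ i ≫ r = 𝟙 X) :
    ∀ (n : ℕ) (X : ModuleCat.{u} T), 𝒞 X → ∃ (Y N : ModuleCat.{u} T) (i : X ⟶ N) (r : N ⟶ X),
      𝒞 Y ∧ IsSyzygy n Y N ∧ i ≫ r = 𝟙 X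
  | 0, X, hX => ⟨X, X, 𝟙 X, 𝟙 X, hX, ⟨Iso.refl X⟩, Category.comp_id _⟩
  | n + 1, X, hX => by
    obtain ⟨Y₁, N₁, i₁, r₁, hY₁, hN₁, hir₁⟩ := hrec X hX
    obtain ⟨Y, N, i, r, hY, hN, hir⟩ := exists_retract_isSyzygy_of_recurrent hfin hrec n Y₁ hY₁
    haveI : Module.Finite T N := finite_of_isSyzygy n (hfin Y hY) hN
    obtain ⟨N', hN'⟩ := exists_isSyzygy_one N
    obtain ⟨Q, hQ, hQproj, i', p', hip'⟩ := exists_retract_isSyzygy_of_retract i r hir hN' hN₁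
    refine ⟨Y, ModuleCat.of T (N' × Q), i₁ ≫ i', p' ≫ r₁, hY, ?_, ?_⟩
    · have := hN.trans (isSyzygy_one_prod_projective hN' hQ hQproj)
      rwa [Nat.add_comm] at this
    · rw [Category.assoc, ← Category.assoc i', hip', Category.id_comp, hir₁]

/-- **`caⁿ⁺¹(T)` stably annihilates every member of a recurrent class** (CA1 at level `n` on the
`n`-th syzygy module of which the member is a retract, then HC-R). [folklore] -/
theorem stablyAnnihilates_of_mem_cohomologyAnnihilatorOfDegree_succ_of_recurrent
    (hfin : ∀ X, 𝒞 X → Module.Finite T X)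
    (hrec : ∀ X, 𝒞 X → ∃ (Y N : ModuleCat.{u} T) (i : X ⟶ N) (r : N ⟶ X),
      𝒞 Y ∧ IsSyzygy 1 Y N ∧ i ≫ r = 𝟙 X)
    {n : ℕ} {x : T} (hx : x ∈ cohomologyAnnihilatorOfDegree T (n + 1)) {X : ModuleCat.{u} T}
    (hX : 𝒞 X) : StablyAnnihilates T x X := by
  obtain ⟨Y, N, i, r, hY, hN, hir⟩ := exists_retract_isSyzygy_of_recurrent 𝒞 hfin hrec n X hX
  exact StablyAnnihilates.of_retract i r hir
    ((mem_cohomologyAnnihilatorOfDegree_succ_iff_forall_isSyzygy x).mp hx Y N (hfin Y hY) hN)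

/-- **`ca(T)` stably annihilates every member of a recurrent class.** [folklore] -/
theorem stablyAnnihilates_of_mem_cohomologyAnnihilator_of_recurrent
    (hfin : ∀ X, 𝒞 X → Module.Finite T X)
    (hrec : ∀ X, 𝒞 X → ∃ (Y N : ModuleCat.{u} T) (i : X ⟶ N) (r : N ⟶ X),
      𝒞 Y ∧ IsSyzygy 1 Y N ∧ i ≫ r = 𝟙 X)
    {x : T} (hx : x ∈ cohomologyAnnihilator T) {X : ModuleCat.{u} T} (hX : 𝒞 X) :
    StablyAnnihilates T x X := by
  obtain ⟨n, hn⟩ := mem_cohomologyAnnihilator_iff.mp hx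
  exact stablyAnnihilates_of_mem_cohomologyAnnihilatorOfDegree_succ_of_recurrent 𝒞 hfin hrec
    (cohomologyAnnihilatorOfDegree_mono (Nat.le_succ n) hn) hX

/-- **THE Ω-RECURRENCE CERTIFICATE (class form).** If some member `X` of a recurrent class is NOT
stably annihilated by `x` (one level-wise exclusion of the engines), then `x ∉ ca(T)`. [folklore] -/
theorem not_mem_cohomologyAnnihilator_of_recurrent (hfin : ∀ X, 𝒞 X → Module.Finite T X)
    (hrec : ∀ X, 𝒞 X → ∃ (Y N : ModuleCat.{u} T) (i : X ⟶ N) (r : N ⟶ X),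
      𝒞 Y ∧ IsSyzygy 1 Y N ∧ i ≫ r = 𝟙 X)
    {x : T} {X : ModuleCat.{u} T} (hX : 𝒞 X) (hxX : ¬ StablyAnnihilates T x X) :
    x ∉ cohomologyAnnihilator T :=
  fun hx => hxX (stablyAnnihilates_of_mem_cohomologyAnnihilator_of_recurrent 𝒞 hfin hrec hx hX)

/-- The same, level by level: `x ∉ caᵐ(T)` for EVERY `m`. [folklore] -/
theorem not_mem_cohomologyAnnihilatorOfDegree_of_recurrent (hfin : ∀ X, 𝒞 X → Module.Finite T X)
    (hrec : ∀ X, 𝒞 X → ∃ (Y N : ModuleCat.{u} T) (i : X ⟶ N) (r : N ⟶ X),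
      𝒞 Y ∧ IsSyzygy 1 Y N ∧ i ≫ r = 𝟙 X)
    {x : T} {X : ModuleCat.{u} T} (hX : 𝒞 X) (hxX : ¬ StablyAnnihilates T x X) (m : ℕ) :
    x ∉ cohomologyAnnihilatorOfDegree T m :=
  fun hx => not_mem_cohomologyAnnihilator_of_recurrent 𝒞 hfin hrec hX hxX
    (cohomologyAnnihilatorOfDegree_le m hx)

/-- **Ext-witness form.** A member `X` of a recurrent class and ONE class `e ∈ Extⁱ(X, N)`, `i ≥ 1`
(any `N`), with `x • e ≠ 0` put `x` outside `ca(T)` (stable annihilation kills positive `Ext`).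
[folklore] -/
theorem not_mem_cohomologyAnnihilator_of_recurrent_of_smul_ext_ne_zero
    (hfin : ∀ X, 𝒞 X → Module.Finite T X)
    (hrec : ∀ X, 𝒞 X → ∃ (Y N : ModuleCat.{u} T) (i : X ⟶ N) (r : N ⟶ X),
      𝒞 Y ∧ IsSyzygy 1 Y N ∧ i ≫ r = 𝟙 X)
    {x : T} {X : ModuleCat.{u} T} (hX : 𝒞 X) {N : ModuleCat.{u} T} {i : ℕ} (hi : 1 ≤ i)
    (e : Ext.{u} X N i) (he : x • e ≠ 0) : x ∉ cohomologyAnnihilator T :=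
  not_mem_cohomologyAnnihilator_of_recurrent 𝒞 hfin hrec hX fun h => he (h.smul_ext_eq_zero N hi e)

end Recurrent

/-! ## One recurrent module -/

section OneModule

variable [IsNoetherianRing T]

omit [IsNoetherianRing T] in
/-- The class of syzygy modules `Ωʲ K`, `j < p`, of a finitely generated `K` that is a retract of a
`p`-th syzygy module of itself is recurrent. [folklore] -/
theorem recurrent_of_retract_isSyzygy {K N : ModuleCat.{u} T} {p : ℕ} (hN : IsSyzygy p K N) (i : K ⟶ N)
    (r : N ⟶ K) (hir : i ≫ r = 𝟙 K) (X : ModuleCat.{u} T)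
    (hX : ∃ j, j < p ∧ IsSyzygy j K X) :
    ∃ (Y N₁ : ModuleCat.{u} T) (i₁ : X ⟶ N₁) (r₁ : N₁ ⟶ X),
      (∃ j, j < p ∧ IsSyzygy j K Y) ∧ IsSyzygy 1 Y N₁ ∧ i₁ ≫ r₁ = 𝟙 X := by
  obtain ⟨j, hj, hjX⟩ := hX
  cases j with
  | zero =>
    obtain ⟨e⟩ := hjX
    obtain ⟨p', rfl⟩ : ∃ p', p = p' + 1 := ⟨p - 1, by omega⟩
    obtain ⟨K', P, hK', hP, hproj, f, g, w, hS⟩ := hN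
    exact ⟨K', N, e.hom ≫ i, r ≫ e.inv, ⟨p', by omega, hK'⟩,
      isSyzygy_one_iff.mpr ⟨P, hP, hproj, f, g, w, hS⟩,
      by rw [Category.assoc, ← Category.assoc i, hir, Category.id_comp, e.hom_inv_id]⟩
  | succ j =>
    obtain ⟨K', P, hK', hP, hproj, f, g, w, hS⟩ := hjX
    exact ⟨K', X, 𝟙 X, 𝟙 X, ⟨j, by omega, hK'⟩, isSyzygy_one_iff.mpr ⟨P, hP, hproj, f, g, w, hS⟩,
      Category.comp_id _⟩

/-- **`ca(T)` stably annihilates a recurrent module**: `K` finitely generated, a retract of a `p`-th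
syzygy module `N` of itself (`p ≥ 1`), `x ∈ ca(T)` ⇒ `x ∈ s̲ann(K)`. [folklore] -/
theorem stablyAnnihilates_of_mem_cohomologyAnnihilator_of_retract_isSyzygy {K N : ModuleCat.{u} T}
    (hK : Module.Finite T K) {p : ℕ} (hp : 0 < p) (hN : IsSyzygy p K N) (i : K ⟶ N) (r : N ⟶ K)
    (hir : i ≫ r = 𝟙 K) {x : T} (hx : x ∈ cohomologyAnnihilator T) : StablyAnnihilates T x K :=
  stablyAnnihilates_of_mem_cohomologyAnnihilator_of_recurrent (fun X => ∃ j, j < p ∧ IsSyzygy j K X)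
    (fun _ ⟨j, _, hjX⟩ => finite_of_isSyzygy j hK hjX) (recurrent_of_retract_isSyzygy hN i r hir)
    hx ⟨0, hp, ⟨Iso.refl K⟩⟩

/-- **THE Ω-RECURRENCE CERTIFICATE (one module).** `K` finitely generated and a retract of a `p`-th
syzygy module of itself, `p ≥ 1` (e.g. `Ωⁿ⁺¹ M ≅ Ωⁿ M ⊕ Ωⁿ M` with `K = Ωⁿ M`, `p = 1`), and `x • 𝟙 K`
does NOT factor through a projective: then `x ∉ ca(T)`. [folklore] -/
theorem not_mem_cohomologyAnnihilator_of_retract_isSyzygy {K N : ModuleCat.{u} T}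
    (hK : Module.Finite T K) {p : ℕ} (hp : 0 < p) (hN : IsSyzygy p K N) (i : K ⟶ N) (r : N ⟶ K)
    (hir : i ≫ r = 𝟙 K) {x : T} (hxK : ¬ StablyAnnihilates T x K) : x ∉ cohomologyAnnihilator T :=
  fun hx => hxK (stablyAnnihilates_of_mem_cohomologyAnnihilator_of_retract_isSyzygy hK hp hN i r hir hx)

/-- The same, level by level: `x ∉ caᵐ(T)` for every `m`. [folklore] -/
theorem not_mem_cohomologyAnnihilatorOfDegree_of_retract_isSyzygy {K N : ModuleCat.{u} T}
    (hK : Module.Finite T K) {p : ℕ} (hp : 0 < p) (hN : IsSyzygy p K N) (i : K ⟶ N) (r : N ⟶ K)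
    (hir : i ≫ r = 𝟙 K) {x : T} (hxK : ¬ StablyAnnihilates T x K) (m : ℕ) :
    x ∉ cohomologyAnnihilatorOfDegree T m :=
  fun hx => not_mem_cohomologyAnnihilator_of_retract_isSyzygy hK hp hN i r hir hxK
    (cohomologyAnnihilatorOfDegree_le m hx)

/-- **Periodic modules** (`K` is a `p`-th syzygy module of itself, `p ≥ 1`; `p = 2`: maximal
Cohen–Macaulay modules over hypersurfaces, the shape of `…PersistenceLostAssembly`): `x ∉ s̲ann(K)` ⇒
`x ∉ ca(T)`. [folklore] -/
theorem not_mem_cohomologyAnnihilator_of_isSyzygy_self {K : ModuleCat.{u} T} (hK : Module.Finite T K)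
    {p : ℕ} (hp : 0 < p) (hKK : IsSyzygy p K K) {x : T} (hxK : ¬ StablyAnnihilates T x K) :
    x ∉ cohomologyAnnihilator T :=
  not_mem_cohomologyAnnihilator_of_retract_isSyzygy hK hp hKK (𝟙 K) (𝟙 K) (Category.comp_id _) hxK

/-- **Base-module form**: `K = Ωⁿ M` (`M` finitely generated) a retract of a `p`-th syzygy module of
itself (`p ≥ 1`; i.e. of an `Ωⁿ⁺ᵖ M`), `x ∉ s̲ann(K)` ⇒ `x ∉ ca(T)`. [folklore] -/
theorem not_mem_cohomologyAnnihilator_of_isSyzygy_of_retract_isSyzygy {M K N : ModuleCat.{u} T}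
    (hM : Module.Finite T M) {n : ℕ} (hK : IsSyzygy n M K) {p : ℕ} (hp : 0 < p) (hN : IsSyzygy p K N)
    (i : K ⟶ N) (r : N ⟶ K) (hir : i ≫ r = 𝟙 K) {x : T} (hxK : ¬ StablyAnnihilates T x K) :
    x ∉ cohomologyAnnihilator T :=
  not_mem_cohomologyAnnihilator_of_retract_isSyzygy (finite_of_isSyzygy n hM hK) hp hN i r hir hxK

omit [IsNoetherianRing T] in
/-- **From an `Ext` class to the stable annihilator of a syzygy**: if `K = Ωⁿ M` and `x • e ≠ 0` for
some `e ∈ Extⁱ(M, N)` with `N` finitely generated and `i ≥ n + 1`, then `x ∉ s̲ann(K)` (stable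
annihilation of `Ωⁿ M` kills `Ext^{≥ 1}(Ωⁿ M, −)`, which maps ONTO `Ext^{≥ n+1}(M, −)`:
`mem_extAnnihilatorFrom_of_isSyzygy`). [cite: IyengarTakahashi2014, Remark 2.3] -/
theorem not_stablyAnnihilates_of_isSyzygy_of_smul_ext_ne_zero {M K : ModuleCat.{u} T} {n : ℕ}
    (hK : IsSyzygy n M K) {x : T} {N : ModuleCat.{u} T} (hNf : Module.Finite T N) {i : ℕ}
    (hi : n + 1 ≤ i) (e : Ext.{u} M N i) (he : x • e ≠ 0) : ¬ StablyAnnihilates T x K := by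
  intro h
  have h1 : x ∈ extAnnihilatorFrom K 1 := by
    rw [mem_extAnnihilatorFrom_iff]
    exact fun j hj N' _ e' => h.smul_ext_eq_zero N' hj e'
  have hM := mem_extAnnihilatorFrom_of_isSyzygy n hK h1
  exact he ((mem_extAnnihilatorFrom_iff.mp hM) i (by omega) N hNf e)

/-- **Ext-witness form of the one-module certificate**: `K = Ωⁿ M` a retract of a `p`-th syzygy module
of itself (`p ≥ 1`) and `x • Extⁱ(M, N) ≠ 0` for some finitely generated `N` and `i ≥ n + 1` ⇒
`x ∉ ca(T)`. [folklore] -/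
theorem not_mem_cohomologyAnnihilator_of_retract_isSyzygy_of_smul_ext_ne_zero {M K N₀ : ModuleCat.{u} T}
    (hM : Module.Finite T M) {n : ℕ} (hK : IsSyzygy n M K) {p : ℕ} (hp : 0 < p) (hN₀ : IsSyzygy p K N₀)
    (i : K ⟶ N₀) (r : N₀ ⟶ K) (hir : i ≫ r = 𝟙 K) {x : T} {N : ModuleCat.{u} T}
    (hNf : Module.Finite T N) {j : ℕ} (hj : n + 1 ≤ j) (e : Ext.{u} M N j) (he : x • e ≠ 0) :
    x ∉ cohomologyAnnihilator T :=
  not_mem_cohomologyAnnihilator_of_isSyzygy_of_retract_isSyzygy hM hK hp hN₀ i r hir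
    (not_stablyAnnihilates_of_isSyzygy_of_smul_ext_ne_zero hK hNf hj e he)

end OneModule

/-! ## Saturation of `ca(T)` from the retract property at ONE level -/

section Saturation

variable [IsNoetherianRing T]

omit [IsNoetherianRing T] in
/-- The class of retracts of `d`-th syzygy modules of finitely generated modules is recurrent as soon as
every `d`-th syzygy module is a retract of a `(d+1)`-th syzygy module (`(SC_d)`): `X` a retract of
`Ωᵈ M`, a retract of `Ωᵈ⁺¹ M' = Ω(Ωᵈ M')`. [folklore] -/
theorem recurrent_of_forall_isSyzygy_retract (d : ℕ)
    (h : ∀ (M K : ModuleCat.{u} T), Module.Finite T M → IsSyzygy d M K →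
      ∃ (M' K' : ModuleCat.{u} T) (i : K ⟶ K') (r : K' ⟶ K),
        Module.Finite T M' ∧ IsSyzygy (d + 1) M' K' ∧ i ≫ r = 𝟙 K)
    (X : ModuleCat.{u} T)
    (hX : ∃ (M K : ModuleCat.{u} T) (i : X ⟶ K) (r : K ⟶ X),
      Module.Finite T M ∧ IsSyzygy d M K ∧ i ≫ r = 𝟙 X) :
    ∃ (Y N : ModuleCat.{u} T) (i₁ : X ⟶ N) (r₁ : N ⟶ X),
      (∃ (M K : ModuleCat.{u} T) (i : Y ⟶ K) (r : K ⟶ Y),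
        Module.Finite T M ∧ IsSyzygy d M K ∧ i ≫ r = 𝟙 Y) ∧ IsSyzygy 1 Y N ∧ i₁ ≫ r₁ = 𝟙 X := by
  obtain ⟨M, K, i, r, hM, hK, hir⟩ := hX
  obtain ⟨M', K', i', r', hM', hK', hir'⟩ := h M K hM hK
  obtain ⟨K'', P, hK'', hP, hproj, f, g, w, hS⟩ := hK'
  refine ⟨K'', K', i ≫ i', r' ≫ r, ⟨M', K'', 𝟙 K'', 𝟙 K'', hM', hK'', Category.comp_id _⟩,
    isSyzygy_one_iff.mpr ⟨P, hP, hproj, f, g, w, hS⟩, ?_⟩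
  rw [Category.assoc, ← Category.assoc i', hir', Category.id_comp, hir]

/-- **`(SC_d)` at one level propagates**: under `(SC_d)` every `d`-th syzygy module of a finitely
generated module is a retract of an `n`-th syzygy module of a finitely generated module, for EVERY `n`.
[folklore] -/
theorem exists_retract_isSyzygy_of_forall_isSyzygy_retract (d : ℕ)
    (h : ∀ (M K : ModuleCat.{u} T), Module.Finite T M → IsSyzygy d M K →
      ∃ (M' K' : ModuleCat.{u} T) (i : K ⟶ K') (r : K' ⟶ K),
        Module.Finite T M' ∧ IsSyzygy (d + 1) M' K' ∧ i ≫ r = 𝟙 K)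
    (n : ℕ) {M K : ModuleCat.{u} T} (hM : Module.Finite T M) (hK : IsSyzygy d M K) :
    ∃ (Y N : ModuleCat.{u} T) (i : K ⟶ N) (r : N ⟶ K),
      Module.Finite T Y ∧ IsSyzygy n Y N ∧ i ≫ r = 𝟙 K := by
  obtain ⟨Y, N, i, r, ⟨M₁, K₁, i₁, r₁, hM₁, hK₁, hir₁⟩, hN, hir⟩ :=
    exists_retract_isSyzygy_of_recurrent
      (fun X => ∃ (M K : ModuleCat.{u} T) (i : X ⟶ K) (r : K ⟶ X),
        Module.Finite T M ∧ IsSyzygy d M K ∧ i ≫ r = 𝟙 X)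
      (fun _ ⟨M₀, K₀, i₀, r₀, hM₀, hK₀, hir₀⟩ => finite_of_retract i₀ r₀ hir₀ (finite_of_isSyzygy d hM₀ hK₀))
      (recurrent_of_forall_isSyzygy_retract d h) n K ⟨M, K, 𝟙 K, 𝟙 K, hM, hK, Category.comp_id _⟩
  exact ⟨Y, N, i, r, finite_of_retract i₁ r₁ hir₁ (finite_of_isSyzygy d hM₁ hK₁), hN, hir⟩

/-- **Saturation from one level, levelled form**: under `(SC_d)`, `caⁿ(T) = caᵈ⁺¹(T)` for every
`n ≥ d + 1`. [folklore] -/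
theorem cohomologyAnnihilatorOfDegree_eq_of_forall_isSyzygy_retract_at (d : ℕ)
    (h : ∀ (M K : ModuleCat.{u} T), Module.Finite T M → IsSyzygy d M K →
      ∃ (M' K' : ModuleCat.{u} T) (i : K ⟶ K') (r : K' ⟶ K),
        Module.Finite T M' ∧ IsSyzygy (d + 1) M' K' ∧ i ≫ r = 𝟙 K)
    {n : ℕ} (hn : d + 1 ≤ n) :
    cohomologyAnnihilatorOfDegree T n = cohomologyAnnihilatorOfDegree T (d + 1) := by
  refine le_antisymm ?_ (cohomologyAnnihilatorOfDegree_mono hn)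
  obtain ⟨m, rfl⟩ : ∃ m, n = m + 1 := ⟨n - 1, by omega⟩
  intro x hx
  rw [mem_cohomologyAnnihilatorOfDegree_succ_iff_forall_isSyzygy]
  intro M K hM hK
  obtain ⟨Y, N, i, r, hY, hN, hir⟩ := exists_retract_isSyzygy_of_forall_isSyzygy_retract d h m hM hK
  exact StablyAnnihilates.of_retract i r hir
    ((mem_cohomologyAnnihilatorOfDegree_succ_iff_forall_isSyzygy x).mp hx Y N hY hN)

/-- **SATURATION FROM ONE LEVEL** `ca(T) = caᵈ⁺¹(T)`: over a noetherian `T`, if every `d`-th syzygy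
module of every finitely generated module is a retract of a `(d+1)`-th syzygy module of a finitely
generated module, then the cohomology annihilator is reached at level `d + 1`.  (The tree's
`…PersistenceSaturationCriterion.cohomologyAnnihilator_eq_of_forall_isSyzygy_retract` assumes this at
every level `m ≥ d`.) [folklore] -/
theorem cohomologyAnnihilator_eq_of_forall_isSyzygy_retract_at (d : ℕ)
    (h : ∀ (M K : ModuleCat.{u} T), Module.Finite T M → IsSyzygy d M K →
      ∃ (M' K' : ModuleCat.{u} T) (i : K ⟶ K') (r : K' ⟶ K),
        Module.Finite T M' ∧ IsSyzygy (d + 1) M' K' ∧ i ≫ r = 𝟙 K) :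
    cohomologyAnnihilator T = cohomologyAnnihilatorOfDegree T (d + 1) := by
  refine le_antisymm ?_ (cohomologyAnnihilatorOfDegree_le _)
  intro x hx
  obtain ⟨n, hn⟩ := mem_cohomologyAnnihilator_iff.mp hx
  have hx' : x ∈ cohomologyAnnihilatorOfDegree T (max n (d + 1)) :=
    cohomologyAnnihilatorOfDegree_mono (le_max_left _ _) hn
  rwa [cohomologyAnnihilatorOfDegree_eq_of_forall_isSyzygy_retract_at d h (le_max_right _ _)] at hx'

end Saturation

end Summit.ResolutionOfSingularities.ResolutionOfSingularities.Theorems.HomologicalConductor.RecurrenceExclusion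

end
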